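import Literature.MathematicalPhysics.QuantumFieldTheory.Balaban1983to89.B9Eq326DeltaAHQKLettersTower
import Literature.MathematicalPhysics.QuantumFieldTheory.Balaban1983to89.B9Eq3126ClosingRadiusWindowTower

/-!
# `Balaban1983to89.B9Eq326DeltaABlockDecayTowerClosedRadius` — T. Bałaban, *Propagators for lattice gauge theories in a background field*, Commun. Math. Phys.
# **99** (1985) 389–434 [Balaban1985BackgroundPropagators] (3.26) p. 395, (3.15)–(3.19) p. 393, (3.49) p. 399 («the constants … independent of the field
# configuration»), (3.79) p. 406, Thm 3.11 p. 416: **THE `L²` BLOCK DECAY OF THE BOND PROPAGATOR `G₁,k(U) = Δ_{a,k}(U)⁻¹` AT EVERY HEIGHT WITH THE RATE CHOSEN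
# ONCE — `∃ r₀ > 0` IN CLOSED FORM BEFORE `∀ n η c₀ c₁ m U`** — the OWNER t4-ne9-p1 g94's (HQKT) `B9Eq326DeltaAHQKLettersTower.norm_block_G1k_le_closed`
# (the `hQK` binder of this lineage's (GBT2) `B9Eq326DeltaABlockDecayTower` inhabited at the chain) at the closing radius of `B9Eq3126ClosingRadiusWindowTower`
# (read at `μ₁ := 1` — the `G₁` row has no `(Q_kG₁Q_k†)⁻¹` window; `ℓ = ℓ′ = 1`, `β := N_βr₀`, `β′ := N′r₀`, `β_K := 8p_K⁰r₀`, `ρ := (6X + 9X)∕√κ₁`; the tower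
# `dQ` window linearised height-free on the diagonal `ηL^{n+1} = 1`, `c₀(L^{n+1})^d = c₁`), given ONLY `γ` + `hpos` (Thm 3.11 for `Δ_{a,k}`), the `G′_k` side
# (`γ′`, `a′`, `hpos′`, `κ₁`, `M`), a bound `p_K⁰` of the curvature letter and the MODEL letters with the geometric bond-window profile — the `G₁` twin of
# `B9Eq3126H1BlockDecayTowerClosedRadius`

statement-level skeleton of published theorems with citation tags; proofs where landed; nothing here is a claim about the Yang–Mills mass gap

CITATION HEADER (lean-in-tree rule).  Audit cell `pub-balaban`, sub-cell `t4`, BINDER row NE9 (road ΔA-CT of the NE9 formalisation swarm, leaf prover 03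
`b2b-balaban-t4-ne9-formalise-leaf-03` gen 77).  Imports BY NAME: the OWNER's (HQKT) `B9Eq326DeltaAHQKLettersTower` (`norm_block_G1k_le_closed`; through it (TQ),
(TR), (QC), this lineage's (GBT2) ∕ (PDCT)) and this lineage's `B9Eq3126ClosingRadiusWindowTower`.  Sources READ first-hand: [Balaban1985BackgroundPropagators]
(`paper:balaban1985-cmp99-background-propagators`, journal page = PDF page + 388) pp. 393, 395, 399, 406, 416.  Print's decay of `G` ((3.49)) is the random walk
of Sect. C; the cell's road is Combes–Thomas with explicit windows; `r₀` is the cell's closed form, NOT print's `δ₀`.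

WHAT IS PROVED (sorry-free; proof lane — no `def`; [folklore] composition BY NAME + the arithmetic of `B9Eq3126ClosingRadiusWindowTower`).
* **`exists_rate_block_decay_G1k_closed`** — for the letters `(d, L ≥ 2, M_φ, M_φ′, M_τ, a, a′, ε_s, ϱ < 1, γ′ ≤ 1, κ₁, M, γ, p_K⁰ < γ∕2)`: `∃ r₀`,
  `r₀ = ` the closed radius of `B9Eq3126ClosingRadiusWindowTower` at `μ₁ := 1`, `0 < r₀`, and for every height `n`, spacing `η` (`ηL^{n+1} = 1`), weights on
  the diagonal, lattice `m`, background `U` of the MODEL letters (unit ball, `hRS`, E162 data, geometric profile `ε_j ≤ ε_sϱ^j`, plaquette letters `δ` with the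
  curvature letter `≤ p_K⁰`), the `G′_k`-side letters, ANY positivity witness `hpos` of `Δ_{a,k}(U)` with `γ`-coercivity:
  `‖P_{y₁} ∘ G₁,k(U) ∘ P_{y₀}‖ ≤ (4∕γ)e^{r₀}·e^{−r₀·d_m(y₀,y₁)}`.
HONEST SCOPE.  Composition; the letters `γ` + `hpos`, `γ′`, `a′`, `hpos′`, `κ₁`, `M`, `p_K⁰` and the MODEL letters are INPUTS (closed suppliers:
`B9Eq3126H1RowLettersDiagonalClosed`; assembled in the sequel `B9Eq326DeltaABlockDecayTowerDiagonalClosed`); crude constants; NOT print's `δ₀`, NOT a kernel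
bound; NOT NE9 (cell pub-balaban: NE9 NOT PRINTED ∕ NOT PROVED; «NE9 ⇐ the named binders»; row WALLED ON A MODEL (O-NE9-1; #5 UNRULED); spine PROVED 0∕9; rung
(B)+1 on a finite T⁴ — NOT infinite volume, NOT mass gap, NOT BetaPertH, NOT Clay; HONEST DEPENDENCY: continuum YM on T⁴ ⇐ BetaPertH ∧ nine spine estimates
(0/9 proved); BetaPertH ⇐ (D1) ∧ (D4) ∧ CAP+tail; G-an2-4 gates asym, D1 and NE2/3/4).  NEW file; nothing modified.  Net new unproved facts: 0.
-/

noncomputable section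

set_option autoImplicit false

open scoped InnerProductSpace ComplexConjugate BigOperators
open NormedSpace

namespace Literature.MathematicalPhysics.QuantumFieldTheory.Balaban1983to89.B9Eq326DeltaABlockDecayTowerClosedRadius

open B4Sect5Torus (TSite tdist)
open B4Sect5Proof (latticeConst)
open B9SectCLatticeCarrier (Bond DirPair bpos btgt)
open B9Eq311L2Pairing (WL2)
open B9Eq319QprimeTorus (fineP blockCoord)
open B9Eq315QTower (towerP UlevOf)
open B9Eq315QTorus (perCfg cornerSite)
open B7Prop1Explicit (U1 Wcx boxVec)
open B9Eq316TowerFlatIsOneStep (siteCast towerP_eq_fineP_pow)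
open B11Eq103H1Complex (SiteL2K BondL2K covDerivL2K covDivL2K)
open B9Eq310DeltaPrime (reHol imHol)
open B9Eq310HessianOperator (adTransportW curvOp)
open B9Eq326OperatorTower (laplaceAk RofUk G1k QkW QprimeTowerW)
open B9Eq324DeltaPrimeATower (laplacePrimeAk GpOfUk)
open B9Eq326DeltaAHQKLettersTower (norm_block_G1k_le_closed)
open B9Eq3126ClosingRadiusWindowTower (radiusT0_pos le_ratios_of_le_radiusT0 eta_windows unit_windows slopes_le small_window tower_dQ_diff_le_linear)

variable {d : ℕ} (L : ℕ) [NeZero L] (hL2 : 2 ≤ L)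
  {𝔸 : Type*} [NormedRing 𝔸] [StarRing 𝔸] [NormedAlgebra ℂ 𝔸] [StarModule ℂ 𝔸] [CompleteSpace 𝔸] [NormOneClass 𝔸]
  {W : Type*} [NormedAddCommGroup W] [InnerProductSpace ℂ W] [FiniteDimensional ℂ W] (φ : W ≃ₗ[ℂ] 𝔸) {Mφ Mφ' : ℝ}
  (hφ : ∀ w, ‖φ w‖ ≤ Mφ * ‖w‖) (hφ' : ∀ X, ‖φ.symm X‖ ≤ Mφ' * ‖X‖) (hMφ : 0 ≤ Mφ) (hMφ' : 0 ≤ Mφ') (hstar : ∀ X : 𝔸, ‖star X‖ ≤ ‖X‖)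
  (τ : 𝔸 →ₗ[ℂ] ℂ) {Mτ : ℝ} (hτ : ∀ X Y : 𝔸, ‖τ (X * Y)‖ ≤ Mτ * ‖X‖ * ‖Y‖) (hMτ : 0 ≤ Mτ)
  (a : ℝ) (ha : 0 ≤ a) {a' : ℝ} (ha' : 0 ≤ a') {ϱ εs : ℝ} (hϱ0 : 0 ≤ ϱ) (hϱ1 : ϱ < 1) (hεs : 0 ≤ εs)
  {γ' κ₁ M : ℝ} (hγ' : 0 < γ') (hγ'1 : γ' ≤ 1) (hκ₁ : 0 < κ₁) (hM : 0 ≤ M)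
  {γ pK0 : ℝ} (hγ : 0 < γ) (hpK0 : 0 ≤ pK0) (hgap : pK0 < γ / 2)

set_option maxHeartbeats 1600000 in
include hL2 hφ hφ' hMφ hMφ' hstar hτ hMτ ha ha' hϱ0 hϱ1 hεs hγ' hγ'1 hκ₁ hM hγ hpK0 hgap in
/-- **THE `L²` BLOCK DECAY OF `G₁,k(U)` AT EVERY HEIGHT, THE RATE CHOSEN ONCE: `∃ r₀ > 0` (closed form, the radius of
`B9Eq3126ClosingRadiusWindowTower` at `μ₁ := 1`) BEFORE `∀ n η c₀ c₁ m U`.**  (HQKT) `norm_block_G1k_le_closed` at `r := r₀`, `ℓ = ℓ′ = 1`, `β := N_βr₀`,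
`β′ := N′r₀`, `β_K := 8p_K⁰r₀`, `ρ := (6X + 9X)∕√κ₁`, every radius window by `B9Eq3126ClosingRadiusWindowTower`, the curvature letter bounded by `p_K⁰`.
Displayed: `γ` + `hpos`, the `G′_k` side, the MODEL letters. [cite: Balaban1985BackgroundPropagators, (3.26) p.395, (3.15)–(3.19) p.393, (3.49) p.399, (3.79) p.406,
Thm 3.11 p.416] -/
theorem exists_rate_block_decay_G1k_closed (d : ℕ) :
    ∃ r₀ : ℝ, r₀ = min (1 / 4) (min (1 / (2 * (d : ℝ) + 1)) (min (1 / (4 * (Mφ * Mφ') * (d * Real.sqrt d) + 4 * (Mφ * Mφ') * d + 2 * (Mφ * Mφ') * Real.sqrt d + Mφ' * Mφ * (Real.exp 1 * Real.exp (Real.sqrt ((L : ℝ) ^ d) * (Real.sqrt (2 * d) * (102 * (d + 1) ^ 2 * L)) * (εs / (1 - ϱ))) * (Real.sqrt ((L : ℝ) ^ d) * ((3 * 1 + (2 * d + 1) * 1) * (2 * Real.sqrt (2 * (2 * d * (102 * (d + 1) ^ 2 * L * εs) ^ 2 + 1)))))) + 1)) (min (1 / (Real.sqrt ((L : ℝ)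 ^ d) * ((3 * 1 + (2 * d + 1) * 1) * (2 * Real.sqrt (2 * (2 * d * (102 * (d + 1) ^ 2 * L * εs) ^ 2 + 1)))))) (min (1 / (2 * (Mφ * Mφ') * Real.sqrt d + 2 * M + 1)) (min (γ' / (12 * (1 + a') * (2 * (Mφ * Mφ') * Real.sqrt d + 2 * M + 1))) (min (Real.sqrt κ₁ / (120 * ((2 * (Mφ * Mφ') * Real.sqrt d + 2 * M + 1) * (4 / γ' + M * ((4 / γ') ^ 2 * (3 + a' * (2 * M + 1))))))) (min ((γ / 4 - pK0 / 2) / ((21 + 3 * a) * (4 * (Mφ * Mφ') * (d * Real.sqrt d) + 4 * (Mφ * Mφ') * d + 2 * (Mφ * Mφ') * Real.sqrt d + Mφ' * Mφ * (Real.exp 1 * Real.exp (Real.sqrt ((L : ℝ) ^ d) * (Real.sqrt (2 * d) * (102 * (d + 1) ^ 2 * L)) * (εs / (1 - ϱ))) * (Real.sqrt ((L : ℝ) ^ d) * ((3 * 1 + (2 * d + 1) * 1) * (2 * Real.sqrt (2 * (2 * d * (102 * (d + 1) ^ 2 * L * εs) ^ 2 + 1)))))) + 1) + 4 * (4 * (Mφ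 * Mφ') * (d * Real.sqrt d) + 4 * (Mφ * Mφ') * d + 2 * (Mφ * Mφ') * Real.sqrt d + Mφ' * Mφ * (Real.exp 1 * Real.exp (Real.sqrt ((L : ℝ) ^ d) * (Real.sqrt (2 * d) * (102 * (d + 1) ^ 2 * L)) * (εs / (1 - ϱ))) * (Real.sqrt ((L : ℝ) ^ d) * ((3 * 1 + (2 * d + 1) * 1) * (2 * Real.sqrt (2 * (2 * d * (102 * (d + 1) ^ 2 * L * εs) ^ 2 + 1)))))) + 1) * Real.sqrt (M / Real.sqrt κ₁) + 2 * (15 * ((2 * (Mφ * Mφ') * Real.sqrt d + 2 * M + 1) * (4 / γ' + M * ((4 / γ') ^ 2 * (3 + a' * (2 * M + 1))))) / Real.sqrt κ₁) * Real.sqrt (M / Real.sqrt κ₁) ^ 2 + 8 * pK0)) (((1 : ℝ) / 2) / ((4 * (Mφ * Mφ') * (d * Real.sqrt d) + 4 * (Mφ * Mφ') * d + 2 * (Mφ * Mφ') * Real.sqrt d + Mφ' * Mφ * (Real.exp 1 * Real.exp (Real.sqrt ((L : ℝ) ^ d) * (Real.sqrt (2 * d) * (102 * (d + 1) ^ 2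 * L)) * (εs / (1 - ϱ))) * (Real.sqrt ((L : ℝ) ^ d) * ((3 * 1 + (2 * d + 1) * 1) * (2 * Real.sqrt (2 * (2 * d * (102 * (d + 1) ^ 2 * L * εs) ^ 2 + 1)))))) + 1) * (4 / γ) * (2 * (Mφ' * Mφ * Real.exp (Real.sqrt ((L : ℝ) ^ d) * (Real.sqrt (2 * d) * (102 * (d + 1) ^ 2 * L)) * (εs / (1 - ϱ)))) + 1) + (Mφ' * Mφ * Real.exp (Real.sqrt ((L : ℝ) ^ d) * (Real.sqrt (2 * d) * (102 * (d + 1) ^ 2 * L)) * (εs / (1 - ϱ)))) * ((Mφ' * Mφ * Real.exp (Real.sqrt ((L : ℝ) ^ d) * (Real.sqrt (2 * d) * (102 * (d + 1) ^ 2 * L)) * (εs / (1 - ϱ)))) + 1) * ((4 * (Mφ * Mφ') * (d * Real.sqrt d) + 4 * (Mφ * Mφ') * d + 2 * (Mφ * Mφ') * Real.sqrt d + Mφ' * Mφ * (Real.exp 1 * Real.exp (Real.sqrt ((L : ℝ) ^ d) * (Real.sqrt (2 * d) * (102 * (d + 1) ^ 2 * L)) * (εs / (1 - ϱ))) * (Real.sqrt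 ((L : ℝ) ^ d) * ((3 * 1 + (2 * d + 1) * 1) * (2 * Real.sqrt (2 * (2 * d * (102 * (d + 1) ^ 2 * L * εs) ^ 2 + 1)))))) + 1) * (4 / γ * (2 * (8 / γ) + (8 / γ + 4 / γ) + 2 * ((8 / γ + 4 / γ * Real.sqrt (M / Real.sqrt κ₁)) + 4 / γ) + a * (Mφ' * Mφ * Real.exp (Real.sqrt ((L : ℝ) ^ d) * (Real.sqrt (2 * d) * (102 * (d + 1) ^ 2 * L)) * (εs / (1 - ϱ)))) * (4 / γ) + a * ((Mφ' * Mφ * Real.exp (Real.sqrt ((L : ℝ) ^ d) * (Real.sqrt (2 * d) * (102 * (d + 1) ^ 2 * L)) * (εs / (1 - ϱ)))) + 1) * (4 / γ))) + (15 * ((2 * (Mφ * Mφ') * Real.sqrt d + 2 * M + 1) * (4 / γ' + M * ((4 / γ') ^ 2 * (3 + a' * (2 * M + 1))))) / Real.sqrt κ₁) * ((8 / γ + 4 / γ * Real.sqrt (M / Real.sqrt κ₁)) * ((8 / γ + 4 / γ * Real.sqrt (M / Real.sqrt κ₁)) + 4 / γ)) + 8 * pK0 * (4 / γ) ^ 2))))))))))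 ∧ 0 < r₀ ∧
      ∀ (n : ℕ) (η : ℝ) (_hη : 0 < η) (_hηL : η * (L : ℝ) ^ (n + 1) = 1) (c₀ c₁ : ℝ) [Fact (0 < c₀)] [Fact (0 < c₁)]
        (_hdiag : c₀ * ((L : ℝ) ^ (n + 1)) ^ d = c₁) (m : Fin d → ℕ) [∀ i, NeZero (m i)] (_hm : ∀ i, 1 ≤ m i)
        (U : Bond d (towerP L m (n + 1)) → 𝔸ˣ) (_hU : ∀ b, U b ∈ U1 𝔸)
        (_hRS : ∀ (b : Bond d (towerP L m (n + 1))) (v u : W), ⟪adTransportW φ U b v, u⟫_ℂ = ⟪v, adTransportW φ (fun b => (U b)⁻¹) b u⟫_ℂ)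
        (α : ℕ → ℝ) (_hα0 : ∀ j, 0 ≤ α j) (hα1 : ∀ j, α j ≤ 1 / 64)
        (hU1 : ∀ (j : ℕ) (x : B7Prop1Explicit.Site d) (k : Fin d), perCfg (towerP L m (j + 1)) (UlevOf L m (n + 1) U j) x k ∈ U1 𝔸)
        (hreg : ∀ (j : ℕ) (y : TSite d (towerP L m j)) (k : Fin d) (ρ' : Fin d → Fin L),
          ‖((Wcx L (perCfg (towerP L m (j + 1)) (UlevOf L m (n + 1) U j)) (cornerSite L y) k (boxVec L ρ') : 𝔸ˣ) : 𝔸) - 1‖ ≤ α j)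
        (εU : ℕ → ℝ) (_hεU : ∀ j, 0 ≤ εU j) (_hUε : ∀ (j : ℕ) (b : Bond d (towerP L m (j + 1))), ‖(UlevOf L m (n + 1) U j b : 𝔸) - 1‖ ≤ εU j)
        (_hεg : ∀ j < n + 1, εU j ≤ εs * ϱ ^ j)
        (δ : ℝ) (_hδ : 0 ≤ δ) (_hRe : ∀ p : B9SectCLatticeCarrier.Plaq d (towerP L m (n + 1)), ‖reHol U p - 1‖ ≤ δ)
        (_hIm : ∀ p : B9SectCLatticeCarrier.Plaq d (towerP L m (n + 1)), ‖imHol U p‖ ≤ δ)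
        (_hpK : (768 * Fintype.card (DirPair d) * Mτ * Mφ ^ 2 * (‖((η : ℂ)) ^ d‖ / c₀) * ‖((η : ℂ))⁻¹‖ ^ 2 * δ) ≤ pK0)
        (hpos' : ∀ x : SiteL2K ℂ d (towerP L m (n + 1)) c₀ W, x ≠ 0 → 0 < RCLike.re ⟪x, laplacePrimeAk L m n φ η U a' (c₁ := c₁) x⟫_ℂ)
        (_coercive : ∀ f : SiteL2K ℂ d (towerP L m (n + 1)) c₀ W, γ' * ‖f‖ ^ 2 ≤ ‖(covDerivL2K ℂ c₀ ((η : ℂ))⁻¹ (adTransportW φ U)) f‖ ^ 2 +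
          a' * ‖((WL2.linearEquiv ℂ ℂ (fun _ : TSite d m => c₁)).symm.toLinearMap ∘ₗ QprimeTowerW L m n φ U (c₀ := c₀)) f‖ ^ 2)
        (_hκ : ∀ ψ : SiteL2K ℂ d m c₁ W, κ₁ * ‖ψ‖ ^ 2 ≤ RCLike.re ⟪ψ,
          (((WL2.linearEquiv ℂ ℂ (fun _ : TSite d m => c₁)).symm.toLinearMap ∘ₗ QprimeTowerW L m n φ U (c₀ := c₀)) ∘ₗ
            GpOfUk L m n φ η U a' (c₁ := c₁) hpos' ∘ₗ GpOfUk L m n φ η U a' (c₁ := c₁) hpos' ∘ₗ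
            LinearMap.adjoint ((WL2.linearEquiv ℂ ℂ (fun _ : TSite d m => c₁)).symm.toLinearMap ∘ₗ QprimeTowerW L m n φ U (c₀ := c₀))) ψ⟫_ℂ)
        (_hMQ : ∀ s : SiteL2K ℂ d (towerP L m (n + 1)) c₀ W,
          ‖((WL2.linearEquiv ℂ ℂ (fun _ : TSite d m => c₁)).symm.toLinearMap ∘ₗ QprimeTowerW L m n φ U (c₀ := c₀)) s‖ ≤ M * ‖s‖)
        (hpos : ∀ x : BondL2K ℂ d (towerP L m (n + 1)) c₀ W, x ≠ 0 →
          0 < RCLike.re ⟪x, laplaceAk L m n φ η U (le_trans one_le_two hL2) α hα1 hU1 hreg τ (c₀ := c₀) (c₁ := c₁) a x⟫_ℂ)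
        (_hcoer : ∀ f : BondL2K ℂ d (towerP L m (n + 1)) c₀ W, γ * ‖f‖ ^ 2 ≤
          RCLike.re ⟪f, laplaceAk L m n φ η U (le_trans one_le_two hL2) α hα1 hU1 hreg τ (c₀ := c₀) (c₁ := c₁) a f⟫_ℂ)
        (PB : TSite d m → BondL2K ℂ d (towerP L m (n + 1)) c₀ W →L[ℂ] BondL2K ℂ d (towerP L m (n + 1)) c₀ W)
        (_hPB : ∀ (y : TSite d m) (f : BondL2K ℂ d (towerP L m (n + 1)) c₀ W) (b : Bond d (towerP L m (n + 1))),
          WL2.equiv ℂ (fun _ : Bond d (towerP L m (n + 1)) => c₀) W (PB y f) b =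
            if blockCoord (L ^ (n + 1)) m (siteCast (towerP_eq_fineP_pow L m (n + 1)) (bpos b)) = y then
              WL2.equiv ℂ (fun _ : Bond d (towerP L m (n + 1)) => c₀) W f b else 0)
        (y₀ y₁ : TSite d m),
        ‖PB y₁ ∘L LinearMap.toContinuousLinearMap (G1k L m n φ η U (le_trans one_le_two hL2) α hα1 hU1 hreg τ (c₀ := c₀) (c₁ := c₁) hpos) ∘L PB y₀‖ ≤
          4 / γ * Real.exp r₀ * Real.exp (-(r₀ * tdist m y₀ y₁)) := by
  have hL1 : 1 ≤ L := le_trans one_le_two hL2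
  refine ⟨_, rfl, radiusT0_pos (d := d) (εs := εs) (ϱ := ϱ) hL1 hMφ hMφ' ha ha' hγ' hκ₁ hM hγ one_pos hpK0 hgap, ?_⟩
  intro n η hη hηL c₀ c₁ _ _ hdiag m _ hm U hU hRS α hα0 hα1 hU1 hreg εU hεU hUε hεg δ hδ hRe hIm hpK hpos' coercive hκ hMQ hpos hcoer PB hPB y₀ y₁
  -- the radius and its nine ratio bounds
  set r₀ : ℝ := min (1 / 4) (min (1 / (2 * (d : ℝ) + 1)) (min (1 / (4 * (Mφ * Mφ') * (d * Real.sqrt d) + 4 * (Mφ * Mφ') * d + 2 * (Mφ * Mφ') * Real.sqrt d + Mφ' * Mφ * (Real.exp 1 * Real.exp (Real.sqrt ((L : ℝ) ^ d) * (Real.sqrt (2 * d) * (102 * (d + 1) ^ 2 * L)) * (εs / (1 - ϱ))) * (Real.sqrt ((L : ℝ) ^ d) * ((3 * 1 + (2 * d + 1) * 1) * (2 * Real.sqrt (2 * (2 * d * (102 * (d + 1) ^ 2 * L * εs) ^ 2 + 1)))))) + 1)) (min (1 / (Real.sqrt ((L : ℝ) ^ d) * ((3 * 1 + (2 * d + 1)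 * 1) * (2 * Real.sqrt (2 * (2 * d * (102 * (d + 1) ^ 2 * L * εs) ^ 2 + 1)))))) (min (1 / (2 * (Mφ * Mφ') * Real.sqrt d + 2 * M + 1)) (min (γ' / (12 * (1 + a') * (2 * (Mφ * Mφ') * Real.sqrt d + 2 * M + 1))) (min (Real.sqrt κ₁ / (120 * ((2 * (Mφ * Mφ') * Real.sqrt d + 2 * M + 1) * (4 / γ' + M * ((4 / γ') ^ 2 * (3 + a' * (2 * M + 1))))))) (min ((γ / 4 - pK0 / 2) / ((21 + 3 * a) * (4 * (Mφ * Mφ') * (d * Real.sqrt d) + 4 * (Mφ * Mφ') * d + 2 * (Mφ * Mφ') * Real.sqrt d + Mφ' * Mφ * (Real.exp 1 * Real.exp (Real.sqrt ((L : ℝ) ^ d) * (Real.sqrt (2 * d) * (102 * (d + 1) ^ 2 * L)) * (εs / (1 - ϱ))) * (Real.sqrt ((L : ℝ) ^ d) * ((3 * 1 + (2 * d + 1) * 1) * (2 * Real.sqrt (2 * (2 * d * (102 * (d + 1) ^ 2 * L * εs) ^ 2 + 1)))))) + 1) + 4 * (4 * (Mφ * Mφ') * (d * Real.sqrt d) +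 4 * (Mφ * Mφ') * d + 2 * (Mφ * Mφ') * Real.sqrt d + Mφ' * Mφ * (Real.exp 1 * Real.exp (Real.sqrt ((L : ℝ) ^ d) * (Real.sqrt (2 * d) * (102 * (d + 1) ^ 2 * L)) * (εs / (1 - ϱ))) * (Real.sqrt ((L : ℝ) ^ d) * ((3 * 1 + (2 * d + 1) * 1) * (2 * Real.sqrt (2 * (2 * d * (102 * (d + 1) ^ 2 * L * εs) ^ 2 + 1)))))) + 1) * Real.sqrt (M / Real.sqrt κ₁) + 2 * (15 * ((2 * (Mφ * Mφ') * Real.sqrt d + 2 * M + 1) * (4 / γ' + M * ((4 / γ') ^ 2 * (3 + a' * (2 * M + 1))))) / Real.sqrt κ₁) * Real.sqrt (M / Real.sqrt κ₁) ^ 2 + 8 * pK0)) (((1 : ℝ) / 2) / ((4 * (Mφ * Mφ') * (d * Real.sqrt d) + 4 * (Mφ * Mφ') * d + 2 * (Mφ * Mφ') * Real.sqrt d + Mφ' * Mφ * (Real.exp 1 * Real.exp (Real.sqrt ((L : ℝ) ^ d) * (Real.sqrt (2 * d) * (102 * (d + 1) ^ 2 * L)) * (εs / (1 - ϱ))) *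 (Real.sqrt ((L : ℝ) ^ d) * ((3 * 1 + (2 * d + 1) * 1) * (2 * Real.sqrt (2 * (2 * d * (102 * (d + 1) ^ 2 * L * εs) ^ 2 + 1)))))) + 1) * (4 / γ) * (2 * (Mφ' * Mφ * Real.exp (Real.sqrt ((L : ℝ) ^ d) * (Real.sqrt (2 * d) * (102 * (d + 1) ^ 2 * L)) * (εs / (1 - ϱ)))) + 1) + (Mφ' * Mφ * Real.exp (Real.sqrt ((L : ℝ) ^ d) * (Real.sqrt (2 * d) * (102 * (d + 1) ^ 2 * L)) * (εs / (1 - ϱ)))) * ((Mφ' * Mφ * Real.exp (Real.sqrt ((L : ℝ) ^ d) * (Real.sqrt (2 * d) * (102 * (d + 1) ^ 2 * L)) * (εs / (1 - ϱ)))) + 1) * ((4 * (Mφ * Mφ') * (d * Real.sqrt d) + 4 * (Mφ * Mφ') * d + 2 * (Mφ * Mφ') * Real.sqrt d + Mφ' * Mφ * (Real.exp 1 * Real.exp (Real.sqrt ((L : ℝ) ^ d) * (Real.sqrt (2 * d) * (102 * (d + 1) ^ 2 * L)) * (εs / (1 - ϱ))) * (Real.sqrt ((L : ℝ) ^ d)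 * ((3 * 1 + (2 * d + 1) * 1) * (2 * Real.sqrt (2 * (2 * d * (102 * (d + 1) ^ 2 * L * εs) ^ 2 + 1)))))) + 1) * (4 / γ * (2 * (8 / γ) + (8 / γ + 4 / γ) + 2 * ((8 / γ + 4 / γ * Real.sqrt (M / Real.sqrt κ₁)) + 4 / γ) + a * (Mφ' * Mφ * Real.exp (Real.sqrt ((L : ℝ) ^ d) * (Real.sqrt (2 * d) * (102 * (d + 1) ^ 2 * L)) * (εs / (1 - ϱ)))) * (4 / γ) + a * ((Mφ' * Mφ * Real.exp (Real.sqrt ((L : ℝ) ^ d) * (Real.sqrt (2 * d) * (102 * (d + 1) ^ 2 * L)) * (εs / (1 - ϱ)))) + 1) * (4 / γ))) + (15 * ((2 * (Mφ * Mφ') * Real.sqrt d + 2 * M + 1) * (4 / γ' + M * ((4 / γ') ^ 2 * (3 + a' * (2 * M + 1))))) / Real.sqrt κ₁) * ((8 / γ + 4 / γ * Real.sqrt (M / Real.sqrt κ₁)) * ((8 / γ + 4 / γ * Real.sqrt (M / Real.sqrt κ₁)) + 4 / γ)) + 8 * pK0 * (4 / γ) ^ 2)))))))))) with hr₀def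
  have hr₀pos : 0 < r₀ := radiusT0_pos (d := d) (εs := εs) (ϱ := ϱ) hL1 hMφ hMφ' ha ha' hγ' hκ₁ hM hγ one_pos hpK0 hgap
  have hr0 : 0 ≤ r₀ := hr₀pos.le
  obtain ⟨h1, h2, h3, h4, h5, h6, h7, h8, -⟩ := le_ratios_of_le_radiusT0 (le_refl r₀)
  -- the windows
  obtain ⟨hwin, hwin0, hwin1, hwin'⟩ := eta_windows (d := d) hL1 n hη hηL hr0 h1 h2
  obtain ⟨hβ0, -, hβ'0, hβ'1, small', hwinκ, hρ0, hρ8, hwinT⟩ := unit_windows hL1 hMφ hMφ' ha' hγ' hκ₁ hM hr0 h3 h4 h5 h6 h7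
  obtain ⟨hβCC, hβC, hβD, hβTs, hβ'D, hβ'Q, -⟩ := slopes_le (d := d) (L := L) (εs := εs) (ϱ := ϱ) hMφ hMφ' hM hpK0 hr0
  have hsmall := small_window hL1 hMφ hMφ' ha ha' hγ' hκ₁ hM hpK0 hr0 h3 h8
  -- the diagonal weight ratio is `1`
  have hc₀ : 0 < c₀ := Fact.out
  have hW1 : Real.sqrt (c₁ / (c₀ * ((L : ℝ) ^ (n + 1)) ^ d)) = 1 := by
    rw [← hdiag, div_self (by positivity), Real.sqrt_one]
  -- `η ≤ 1` and the curvature letter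
  have hL1r : (1 : ℝ) ≤ (L : ℝ) ^ (n + 1) := one_le_pow₀ (by exact_mod_cast hL1)
  have hη1 : η ≤ 1 := by
    have hηeq : η = ((L : ℝ) ^ (n + 1))⁻¹ := eq_inv_of_mul_eq_one_left hηL
    rw [hηeq]; exact inv_le_one_of_one_le₀ hL1r
  have hpKnn : 0 ≤ (768 * Fintype.card (DirPair d) * Mτ * Mφ ^ 2 * (‖((η : ℂ)) ^ d‖ / c₀) * ‖((η : ℂ))⁻¹‖ ^ 2 * δ) := by positivity
  have hβK : 8 * (r₀ * (1 * η)) * (768 * Fintype.card (DirPair d) * Mτ * Mφ ^ 2 * (‖((η : ℂ)) ^ d‖ / c₀) * ‖((η : ℂ))⁻¹‖ ^ 2 * δ) ≤ 8 * pK0 * r₀ := by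
    have h1' : r₀ * (1 * η) ≤ r₀ := by rw [one_mul]; exact mul_le_of_le_one_right hr0 hη1
    calc 8 * (r₀ * (1 * η)) * (768 * Fintype.card (DirPair d) * Mτ * Mφ ^ 2 * (‖((η : ℂ)) ^ d‖ / c₀) * ‖((η : ℂ))⁻¹‖ ^ 2 * δ) ≤ 8 * r₀ * pK0 := by
          apply mul_le_mul (by linarith) hpK hpKnn (by positivity)
      _ = 8 * pK0 * r₀ := by ring
  -- the tower `dQ` window, linearised
  have hdiff := tower_dQ_diff_le_linear (d := d) hL2 n hηL εU hεU hϱ0 hϱ1 hεs hεg hr0 zero_le_one zero_le_one hwinT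
  have hβT : Mφ' * Mφ * Real.sqrt (c₁ / (c₀ * ((L : ℝ) ^ (n + 1)) ^ d)) *
      ((∏ j ∈ Finset.range (n + 1), (1 + Real.sqrt ((L : ℝ) ^ d) * (Real.sqrt (2 * d) * (102 * (d + 1) ^ 2 * L * εU j) +
          2 * (r₀ * (if j = 0 then 3 * 1 + (L : ℝ) ^ (n + 1) * (1 * η) else 2 * d * (L : ℝ) ^ (n + 1 - j) * (1 * η))) *
            Real.sqrt (2 * (2 * d * (102 * (d + 1) ^ 2 * L * εU j) ^ 2 + ((L : ℝ) ^ d)⁻¹))))) -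
        ∏ j ∈ Finset.range (n + 1), (1 + Real.sqrt ((L : ℝ) ^ d) * (Real.sqrt (2 * d) * (102 * (d + 1) ^ 2 * L * εU j)))) ≤ (4 * (Mφ * Mφ') * (d * Real.sqrt d) + 4 * (Mφ * Mφ') * d + 2 * (Mφ * Mφ') * Real.sqrt d + Mφ' * Mφ * (Real.exp 1 * Real.exp (Real.sqrt ((L : ℝ) ^ d) * (Real.sqrt (2 * d) * (102 * (d + 1) ^ 2 * L)) * (εs / (1 - ϱ))) * (Real.sqrt ((L : ℝ) ^ d) * ((3 * 1 + (2 * d + 1) * 1) * (2 * Real.sqrt (2 * (2 * d * (102 * (d + 1) ^ 2 * L * εs) ^ 2 + 1)))))) + 1) * r₀ := by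
    have hMM1 : Mφ' * Mφ * Real.sqrt (c₁ / (c₀ * ((L : ℝ) ^ (n + 1)) ^ d)) = Mφ' * Mφ := by rw [hW1, mul_one]
    rw [hMM1]
    have hMM : 0 ≤ Mφ' * Mφ := mul_nonneg hMφ' hMφ
    have hlin : (∏ j ∈ Finset.range (n + 1), (1 + Real.sqrt ((L : ℝ) ^ d) * (Real.sqrt (2 * d) * (102 * (d + 1) ^ 2 * L * εU j) +
          2 * (r₀ * (if j = 0 then 3 * 1 + (L : ℝ) ^ (n + 1) * (1 * η) else 2 * d * (L : ℝ) ^ (n + 1 - j) * (1 * η))) *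
            Real.sqrt (2 * (2 * d * (102 * (d + 1) ^ 2 * L * εU j) ^ 2 + ((L : ℝ) ^ d)⁻¹))))) -
        ∏ j ∈ Finset.range (n + 1), (1 + Real.sqrt ((L : ℝ) ^ d) * (Real.sqrt (2 * d) * (102 * (d + 1) ^ 2 * L * εU j))) ≤ (Real.exp 1 * Real.exp (Real.sqrt ((L : ℝ) ^ d) * (Real.sqrt (2 * d) * (102 * (d + 1) ^ 2 * L)) * (εs / (1 - ϱ))) * (Real.sqrt ((L : ℝ) ^ d) * ((3 * 1 + (2 * d + 1) * 1) * (2 * Real.sqrt (2 * (2 * d * (102 * (d + 1) ^ 2 * L * εs) ^ 2 + 1)))))) * r₀ := by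
      refine hdiff.trans (le_of_eq ?_); ring
    exact (mul_le_mul_of_nonneg_left hlin hMM).trans hβTs
  -- `small` with the curvature letter bounded by `p_K⁰`
  have small : (768 * Fintype.card (DirPair d) * Mτ * Mφ ^ 2 * (‖((η : ℂ)) ^ d‖ / c₀) * ‖((η : ℂ))⁻¹‖ ^ 2 * δ) / 2 + (21 + 3 * a) * ((4 * (Mφ * Mφ') * (d * Real.sqrt d) + 4 * (Mφ * Mφ') * d + 2 * (Mφ * Mφ') * Real.sqrt d + Mφ' * Mφ * (Real.exp 1 * Real.exp (Real.sqrt ((L : ℝ) ^ d) * (Real.sqrt (2 * d) * (102 * (d + 1) ^ 2 * L)) * (εs / (1 - ϱ))) * (Real.sqrt ((L : ℝ) ^ d) * ((3 * 1 + (2 * d + 1) * 1) * (2 * Real.sqrt (2 * (2 * d * (102 * (d + 1) ^ 2 * L * εs) ^ 2 + 1)))))) + 1) * r₀) ^ 2 + 4 * ((4 * (Mφ * Mφ') * (d * Real.sqrt d) + 4 * (Mφ * Mφ') * d + 2 * (Mφ * Mφ') * Real.sqrt d + Mφ' * Mφ * (Real.exp 1 * Real.exp (Real.sqrt ((L : ℝ)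 ^ d) * (Real.sqrt (2 * d) * (102 * (d + 1) ^ 2 * L)) * (εs / (1 - ϱ))) * (Real.sqrt ((L : ℝ) ^ d) * ((3 * 1 + (2 * d + 1) * 1) * (2 * Real.sqrt (2 * (2 * d * (102 * (d + 1) ^ 2 * L * εs) ^ 2 + 1)))))) + 1) * r₀) * Real.sqrt (M / Real.sqrt κ₁) +
      2 * ((6 * ((2 * (Mφ * Mφ') * Real.sqrt d + 2 * M + 1) * r₀ * (4 / γ' + M * ((4 / γ') ^ 2 * (3 + a' * (2 * M + 1))))) + 9 * ((2 * (Mφ * Mφ') * Real.sqrt d + 2 * M + 1) * r₀ * (4 / γ' + M * ((4 / γ') ^ 2 * (3 + a' * (2 * M + 1)))))) / Real.sqrt κ₁) * (Real.sqrt (M / Real.sqrt κ₁)) ^ 2 + 8 * pK0 * r₀ ≤ γ / 4 := by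
    have : (768 * Fintype.card (DirPair d) * Mτ * Mφ ^ 2 * (‖((η : ℂ)) ^ d‖ / c₀) * ‖((η : ℂ))⁻¹‖ ^ 2 * δ) / 2 ≤ pK0 / 2 := by linarith
    linarith [hsmall]
  exact norm_block_G1k_le_closed L m n φ hφ hφ' hMφ hMφ' hstar hη hηL U hU hRS τ hτ hMτ hL1 hm α hα1 hU1 hreg εU hεU hUε
    hδ hRe hIm ha' hpos' hγ' hγ'1 hκ₁ hM coercive hκ hMQ (r := r₀) (ℓ := 1) (ℓ' := 1) hr0 le_rfl le_rfl hβ'0 hβ'1 hwin hwin0 hwin1 hwin' hβT hβK hβ'D hβ'Q small' hwinκ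
    le_rfl a ha hpos hγ hβ0 hρ0 hρ8 hcoer hβCC hβC hβD small PB hPB y₀ y₁

end Literature.MathematicalPhysics.QuantumFieldTheory.Balaban1983to89.B9Eq326DeltaABlockDecayTowerClosedRadius

end
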